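import Literature.Computability.Complexity.MurrayWilliams2018SimulationProofs
import Literature.Computability.Complexity.MurrayWilliams2018HardLanguage
import Literature.Computability.Complexity.MurrayWilliams2018DSR
import Literature.Computability.Complexity.CountingDiagonalization
import HarnessLib

/-!
# Murray–Williams 2018, Lemma 4.1: the residual obligation, in the tree's Theorem-3.1 vocabulary

Literature / circuit complexity. After `MurrayWilliams2018EasyWitnessAssembly.lean` (Lemma 4.1
from `h31` + `hsim`) and `MurrayWilliams2018SimulationProofs.lean` (`hsim` from a generator of
Umans' type), the named fact `MurrayWilliams2018_lemma_4_1_ae` rests on Theorem 3.1 in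
universal-referee form (`h31`). Meanwhile the tree has proved the HARDNESS HALF of Theorem 3.1
for an explicit language: `AlmostAE.hardLang Lstar Ldiag s₁ s₂` (`MurrayWilliams2018HardLanguage.lean`,
`eventually_lt_circuitSize_hardLang_or`), over an abstract paddable, downward self-reducible
`Lstar` (`AlmostAE.DSR`, `MurrayWilliams2018DSR.lean`) and any `Ldiag` hard at large lengths,
supplied by counting (`GreedyHard.diag`, `CountingDiagonalization.lean`). This file joins the two
lines: it PROVES that `h31` — hence Lemma 4.1 — follows from the ONE statement those files name
as "what then remains of Thm. 3.1": the Merlin–Arthur UPPER BOUND for `hardLang`, here in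
universal-referee form,

  `hprot`: for a fixed `Lstar` (paddable, no all-ones word, downward self-reducible), ONE referee
  `Ref ∈ P` and ONE `D₀ ≥ 1` such that for all strictly increasing time-constructible `s` with
  `n · s(n)² < 2ⁿ` a.e., all time-constructible `s₁, s₂` and every `D ≥ D₀`, with
  `(n + s n + 2)^D ≤ s₂ n` and `s (s₂ n)^D ≤ s₁ n` and `(n + s n + 2)^D ≤ s₁ n` a.e., there are
  advice strings of length `≤ D₀ (log₂ s₂(n) + 1)` under which the two-move game with referee
  `Ref` at move length `(s₁(n) · s₂(n))^D` decides `hardLang Lstar (GreedyHard.diag s) s₁ s₂`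
  with the MA promise on all inputs (`AdvisedMAGame`)

(the protocol `M₁` of §3 with its advice `αₙ`, Merlin's circuit for `Lstar` and the instance
checker of `Lstar` — Santhanam's checkable complete language or a `#P`-style substitute — as a
polynomial-time referee uniform in `s`; the constraints are those the assembly can supply,
`h31_of_thm_3_1_universal`):

* `h31_of_hardLang_protocol` — `hprot` gives the general universal-referee form of Theorem 3.1
  used by `MurrayWilliams2018_lemma_4_1_ae_of_thm_3_1_universal_of_simulation`: with the
  downward-self-reduction overhead `q` of `Lstar` (`DSR.exists_circuitSize_succ_le`) dominated by
  `u^{A+1}` (`MWSimN.exists_exp_dominating`), take `D = max (D₀, A + 1, 2)`; then the assembly's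
  constraints give the tree's (ii) `s(s₂ n) + 2 ≤ s₁(n)`, (iii) `q(ℓ + s(m) + 2) ≤ s₁(m)`
  (`ℓ < m`) and `n ≤ s₂(n)`, the smallness `n · s(n)² < 2ⁿ` gives `30 ≤ s(n)` and
  `(s(n) + 4)² ≤ 2ⁿ` for `GreedyHard.eventually_lt_circuitSize_diag`, and
  `eventually_lt_circuitSize_hardLang_or` is the hardness disjunction;
* **`MurrayWilliams2018_lemma_4_1_ae_of_hardLang_protocol_of_umansGenerator`** — Lemma 4.1
  (a.e. form) from `hprot` and a `G : UmansGenerator`;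
* `MurrayWilliams2018_lemma_4_1_ae_of_hardLang_protocol_of_simulation` — the same with the
  simulation hypothesis `hsim` kept abstract.

Theorems only; nothing is asserted; no named fact is introduced (D-0026).

## References

* C. D. Murray, R. R. Williams, *Circuit lower bounds for nondeterministic quasi-polytime: an easy
  witness lemma for NP and NQP*, STOC 2018 = SIAM J. Comput. 49(5) (2020), Thm. 3.1 (the protocol
  `M₁`, "MA promise and running time analysis"), Lemma 4.1 [MurrayWilliams2018].
-/

noncomputable section

namespace Literature.Computability.Complexity

open _root_.Computability Filter Polynomial

/-- **Theorem 3.1 in universal-referee form from a universal protocol for `hardLang`.** See the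
module docstring: the hardness half is the tree's `AlmostAE.eventually_lt_circuitSize_hardLang_or`
with `Ldiag = GreedyHard.diag s`, the constraints being derived from the assembly's generous ones
with `D = max (D₀, A + 1, 2)`, `A` dominating the downward-self-reduction overhead of `Lstar`.
[cite: MurrayWilliams2018, Thm. 3.1] -/
theorem h31_of_hardLang_protocol (Lstar : Language Bool)
    (hpad : ∀ z : List Bool, true :: z ∈ Lstar ↔ z ∈ Lstar)
    (hones : ∀ b : ℕ, List.replicate b true ∉ Lstar) (R : AlmostAE.DSR Lstar)
    (hprot : ∃ Ref : Language Bool, Ref ∈ Classes.P ∧ ∃ D₀ : ℕ, 1 ≤ D₀ ∧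
      ∀ (s s₁ s₂ : ℕ → ℕ) (D : ℕ), D₀ ≤ D → StrictMono s → IsTimeConstructible s →
        (∀ᶠ n in atTop, n * s n ^ 2 < 2 ^ n) →
        IsTimeConstructible s₁ → IsTimeConstructible s₂ →
        (∀ᶠ n in atTop, (n + s n + 2) ^ D ≤ s₂ n) → (∀ᶠ n in atTop, s (s₂ n) ^ D ≤ s₁ n) →
        (∀ᶠ n in atTop, (n + s n + 2) ^ D ≤ s₁ n) →
        ∃ adv : ℕ → List Bool, (∀ n, (adv n).length ≤ D₀ * (Nat.log 2 (s₂ n) + 1)) ∧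
          AdvisedMAGame Ref (fun n => (s₁ n * s₂ n) ^ D) adv
            (AlmostAE.hardLang Lstar (GreedyHard.diag s) s₁ s₂)) :
    ∃ Ref : Language Bool, Ref ∈ Classes.P ∧ ∃ D : ℕ, 1 ≤ D ∧
      ∀ (s s₁ s₂ : ℕ → ℕ), StrictMono s → IsTimeConstructible s →
        (∀ᶠ n in atTop, n * s n ^ 2 < 2 ^ n) →
        IsTimeConstructible s₁ → IsTimeConstructible s₂ →
        (∀ᶠ n in atTop, (n + s n + 2) ^ D ≤ s₂ n) → (∀ᶠ n in atTop, s (s₂ n) ^ D ≤ s₁ n) →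
        (∀ᶠ n in atTop, (n + s n + 2) ^ D ≤ s₁ n) →
        ∃ (adv : ℕ → List Bool) (L₁ : Language Bool),
          (∀ n, (adv n).length ≤ D * (Nat.log 2 (s₂ n) + 1)) ∧
          AdvisedMAGame Ref (fun n => (s₁ n * s₂ n) ^ D) adv L₁ ∧
          ∀ᶠ n in atTop, s n < L₁.circuitSize n ∨ s (s₂ n) < L₁.circuitSize (s₂ n) := by
  obtain ⟨Ref, hRef, D₀, hD₀, H⟩ := hprot
  obtain ⟨q, hq⟩ := R.exists_circuitSize_succ_le
  obtain ⟨A, hA⟩ := MWSimN.exists_exp_dominating q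
  set D : ℕ := max (max D₀ (A + 1)) 2 with hDdef
  have hD₀D : D₀ ≤ D := (le_max_left _ _).trans (le_max_left _ _)
  have hAD : A + 1 ≤ D := (le_max_right _ _).trans (le_max_left _ _)
  have h2D : 2 ≤ D := le_max_right _ _
  refine ⟨Ref, hRef, D, hD₀.trans hD₀D, fun s s₁ s₂ hs hsc hsmall h₁ h₂ hi hii hiii => ?_⟩
  obtain ⟨adv, hadv, hgame⟩ := H s s₁ s₂ D hD₀D hs hsc hsmall h₁ h₂ hi hii hiii
  refine ⟨adv, AlmostAE.hardLang Lstar (GreedyHard.diag s) s₁ s₂,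
    fun n => (hadv n).trans (Nat.mul_le_mul_right _ hD₀D), hgame, ?_⟩
  -- the hardness half of Theorem 3.1 for `hardLang`
  have hsn : ∀ n, n ≤ s n := fun n => hs.id_le n
  have hs₂ : ∀ᶠ n in atTop, n ≤ s₂ n := by
    filter_upwards [hi] with n hn
    exact le_trans (le_trans (by omega) (Nat.le_self_pow (by omega) _)) hn
  -- (ii): `s (s₂ n) + 2 ≤ s (s₂ n) ^ 2 ≤ s (s₂ n) ^ D ≤ s₁ n`
  have hii' : ∀ᶠ n in atTop, s (s₂ n) + 2 ≤ s₁ n := by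
    filter_upwards [hii, hs₂, eventually_ge_atTop 2] with n hn hn₂ h2
    have hx : 2 ≤ s (s₂ n) := h2.trans (hn₂.trans (hsn _))
    have h1 : s (s₂ n) + 2 ≤ s (s₂ n) ^ 2 := by nlinarith
    exact h1.trans ((Nat.pow_le_pow_right (by omega) h2D).trans hn)
  -- (iii): `q (ℓ + s m + 2) ≤ q (m + s m + 2) ≤ (m + s m + 2)^{A+1} ≤ (m + s m + 2)^D ≤ s₁ m`
  have hiii' : ∀ᶠ m in atTop, ∀ ℓ < m, q.eval (ℓ + (s m + 2)) ≤ s₁ m := by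
    filter_upwards [hiii, eventually_ge_atTop (A + A)] with m hm hmA ℓ hℓ
    have hu : A * 1 ^ A + A ≤ m + s m + 2 := by rw [one_pow, mul_one]; omega
    have h1 : q.eval (ℓ + (s m + 2)) ≤ q.eval (1 * (m + s m + 2)) :=
      TM2Iter.eval_mono q (by omega)
    have h2 := hA 1 (m + s m + 2) le_rfl (by omega) hu
    have h3 : (m + s m + 2) ^ (A + 1) ≤ (m + s m + 2) ^ D := Nat.pow_le_pow_right (by omega) hAD
    exact h1.trans (h2.trans (h3.trans hm))
  -- Thm. 2.3 for the counting diagonal language, from the smallness of `s`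
  have hdiag : ∀ᶠ n in atTop, s n < (GreedyHard.diag s).circuitSize n := by
    refine GreedyHard.eventually_lt_circuitSize_diag ?_
    filter_upwards [hsmall, eventually_ge_atTop 30] with n hn h30
    have hs30 : 30 ≤ s n := h30.trans (hsn n)
    refine ⟨hs30, ?_⟩
    have h1 : (s n + 4) ^ 2 ≤ 4 * s n ^ 2 := by nlinarith
    have h2 : 4 * s n ^ 2 ≤ n * s n ^ 2 := Nat.mul_le_mul_right _ (by omega)
    omega
  exact AlmostAE.eventually_lt_circuitSize_hardLang_or (D := fun ℓ S => q.eval (ℓ + S)) hpad hones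
    hs₂ hii' hiii' hq hdiag

/-- **Lemma 4.1 (a.e. form) from a universal protocol for `hardLang` and the derandomised advice
simulation** (kept abstract). [cite: MurrayWilliams2018, Lemma 4.1] -/
theorem MurrayWilliams2018_lemma_4_1_ae_of_hardLang_protocol_of_simulation (Lstar : Language Bool)
    (hpad : ∀ z : List Bool, true :: z ∈ Lstar ↔ z ∈ Lstar)
    (hones : ∀ b : ℕ, List.replicate b true ∉ Lstar) (R : AlmostAE.DSR Lstar)
    (hprot : ∃ Ref : Language Bool, Ref ∈ Classes.P ∧ ∃ D₀ : ℕ, 1 ≤ D₀ ∧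
      ∀ (s s₁ s₂ : ℕ → ℕ) (D : ℕ), D₀ ≤ D → StrictMono s → IsTimeConstructible s →
        (∀ᶠ n in atTop, n * s n ^ 2 < 2 ^ n) →
        IsTimeConstructible s₁ → IsTimeConstructible s₂ →
        (∀ᶠ n in atTop, (n + s n + 2) ^ D ≤ s₂ n) → (∀ᶠ n in atTop, s (s₂ n) ^ D ≤ s₁ n) →
        (∀ᶠ n in atTop, (n + s n + 2) ^ D ≤ s₁ n) →
        ∃ adv : ℕ → List Bool, (∀ n, (adv n).length ≤ D₀ * (Nat.log 2 (s₂ n) + 1)) ∧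
          AdvisedMAGame Ref (fun n => (s₁ n * s₂ n) ^ D) adv
            (AlmostAE.hardLang Lstar (GreedyHard.diag s) s₁ s₂))
    (hsim : ∀ Ref : Language Bool, Ref ∈ Classes.P → ∃ k c₀ : ℕ, 1 ≤ k ∧
      ∀ (t m : ℕ → ℕ) (a : ℕ), IsTimeConstructible t → Monotone t → IsTimeConstructible m →
        (∀ᶠ n in atTop, m n ≤ t n) →
        ∀ {L : Language Bool} (V : NVerifier t L) (w : ℕ → ℕ) (adv : ℕ → List Bool)
          (L₁ : Language Bool),
          (∀ᶠ n in atTop, (adv n).length ≤ a * n) → AdvisedMAGame Ref m adv L₁ →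
          ∃ N' : Language Bool, (∀ e : ℕ, k ≤ e → N' ∈ NTIME (fun n => t n ^ e)) ∧
            ∀ᶠ n in atTop, ∀ xh : List Bool, xh ∈ L → xh.length = n →
              (∀ y : List Bool, y.length ≤ V.c * t xh.length + V.c → V.rel xh y = true →
                w xh.length < stringCC y) →
              ∀ ℓ : ℕ, n ≤ ℓ → (ℓ + m ℓ) ^ k ≤ w n → DecidesOnWithAdvice N' (c₀ * (a + 1)) L₁ ℓ) :
    MurrayWilliams2018_lemma_4_1_ae :=
  MurrayWilliams2018_lemma_4_1_ae_of_thm_3_1_universal_of_simulation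
    (h31_of_hardLang_protocol Lstar hpad hones R hprot) hsim

/-- **Lemma 4.1 (a.e. form) from a universal protocol for `hardLang` and a generator of Umans'
type** — the residual form of the named fact `MurrayWilliams2018_lemma_4_1_ae` in the tree's own
Theorem-3.1 vocabulary: what remains is the Merlin–Arthur upper bound for `AlmostAE.hardLang`
(a polynomial-time referee uniform in `s`, for a fixed paddable downward self-reducible checkable
`Lstar`) and Umans' generator. [cite: MurrayWilliams2018, Lemma 4.1] -/
theorem MurrayWilliams2018_lemma_4_1_ae_of_hardLang_protocol_of_umansGenerator
    (Lstar : Language Bool)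
    (hpad : ∀ z : List Bool, true :: z ∈ Lstar ↔ z ∈ Lstar)
    (hones : ∀ b : ℕ, List.replicate b true ∉ Lstar) (R : AlmostAE.DSR Lstar)
    (hprot : ∃ Ref : Language Bool, Ref ∈ Classes.P ∧ ∃ D₀ : ℕ, 1 ≤ D₀ ∧
      ∀ (s s₁ s₂ : ℕ → ℕ) (D : ℕ), D₀ ≤ D → StrictMono s → IsTimeConstructible s →
        (∀ᶠ n in atTop, n * s n ^ 2 < 2 ^ n) →
        IsTimeConstructible s₁ → IsTimeConstructible s₂ →
        (∀ᶠ n in atTop, (n + s n + 2) ^ D ≤ s₂ n) → (∀ᶠ n in atTop, s (s₂ n) ^ D ≤ s₁ n) →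
        (∀ᶠ n in atTop, (n + s n + 2) ^ D ≤ s₁ n) →
        ∃ adv : ℕ → List Bool, (∀ n, (adv n).length ≤ D₀ * (Nat.log 2 (s₂ n) + 1)) ∧
          AdvisedMAGame Ref (fun n => (s₁ n * s₂ n) ^ D) adv
            (AlmostAE.hardLang Lstar (GreedyHard.diag s) s₁ s₂))
    (G : UmansGenerator) : MurrayWilliams2018_lemma_4_1_ae :=
  MurrayWilliams2018_lemma_4_1_ae_of_thm_3_1_universal_of_umansGenerator
    (h31_of_hardLang_protocol Lstar hpad hones R hprot) G

end Literature.Computability.Complexity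

end
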